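import Summits.QuantumFields.YangMills.Theorems.BalabanLadderIRKernelEnergyGap
import Summits.QuantumFields.YangMills.Theorems.BalabanLadderIRTypLocalExcess
import HarnessLib

/-!
# `IR` — THE ZERO-TEMPERATURE ENERGY-GAP KERNEL BOUND (II: the excess event is closed; faithful representations)

Sequel of `…Theorems.BalabanLadderIRKernelEnergyGap` (same namespace `…Theorems.IRKernelLargeField`), crux `IR`
(stmt-QuantumFields-19354), slot «af-pincer-Uc», first internal target (A′) of `stub_onsetUc` (single-cell rarity of the
local-excess factor `Typ_lx^int`).  Count-neutral helper (`--supports stmt-QuantumFields-19354 --as helper`).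

* §4 (`continuous_pinnedEnergy`, `continuous_pinnedInf`, `mem_excessSet_iff`, `isClosed_excessSet`,
  `measurableSet_excessSet`, `kernel_measureReal_excessSet_le_of_subset`) — the excess event
  `excessSet ρ E E₀ = {U | inf_ζ S_E(ζ ∨ U) + E₀ ≤ S_E(U)}` is CLOSED (the pinned infimum is a continuous function of the
  configuration: Mathlib `IsCompact.continuous_sInf` on the compact fibre `G^E`) and measurable, so the excess-event
  bound of part I applies to `A = excessSet ρ E E₀` itself: for `E ⊆ Λ`, every exterior `ζ`, `δ ≥ 0` with
  `Haar{‖ρ g − 1‖_F ≤ δ} ≥ m > 0`:  `γ_Λ(excessSet ρ E E₀ | ζ) ≤ exp(4 √N β δ · #(plaquettesTouching E) − β E₀) / m^{#E}`.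
* §5 (`kernel_measureReal_excess_le_rep`, `kernel_measureReal_excessSet_le_rep`,
  `kernel_measureReal_biUnion_excessSet_le_rep`) — for every faithful `LatticeRep r` at the zero-temperature scale
  `δ = 1/β` (small-ball constant `C₁` of `exists_haar_gball_ge`, `D = dimE r.ρ`): for all `β ≥ 1`, `E ⊆ Λ`, `ζ`, `E₀`:
  `γ_Λ(excessSet | ζ) ≤ exp(4 √N · #(plaquettesTouching E) − β E₀) / (C₁ β^{−D})^{#E}`, and the union bound over a
  finite family of windows `W i ⊆ Λ` with levels `E₀ i` (the shape of a cell's multi-scale local-excess atypicality).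

* §6 (`setOf_not_localExcess_subset_excessSet`, `compl_typLxInt_subset`, `kernel_measureReal_compl_typLxInt_le_rep`) —
  BRIDGE to the lead's port `…Theorems.IRTypLocalExcess` (p516050, certideate-1 Sketch-g10): on an INTERIOR ball, failing
  `LocalExcess` at level `E` is membership of `excessSet ρ (ballLinks w c R x) E` (`dirichletAction_eq_wilsonBoundaryAction`);
  hence `(TypLxInt ρ w ↑Rs E c)ᶜ ⊆ ⋃_{(R,x) ∈ Rs × cellSites w c} excessSet (ballLinks w c R x) (E R)` for a finite scale
  set `Rs`, and for every faithful `LatticeRep`, every `Λ ⊇ cellEdges w c` and EVERY exterior `ζ`: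
  `γ_Λ((Typ_lx^int c)ᶜ | ζ) ≤ Σ_{(R,x)} exp(4 √N #touch(R,x) − β E R) / (C₁ β^{−D})^{#ballLinks(R,x)}` — the any-exterior
  single-cell rarity of the local-excess factor with an explicit budget (what (A′) asks of this factor, up to the
  lead's choice of scales making the sum `≤ δ`).

Everything here is proved (no `sorry`, no new axioms).  HONEST FRAMING: as in part I — one window's energy–entropy bound
with the polynomial prefactor `β^{D #E}`; clause (i) and the onset statement carry the IR weight; conditional chain
(Track A) untouched; not a gap, not Clay.
-/

set_option autoImplicit false

noncomputable section

open MeasureTheory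
open scoped ENNReal Matrix.Norms.Frobenius
open Literature.Probability.LatticeModels
open Literature.MathematicalPhysics.QuantumLattice
open Literature.MathematicalPhysics.QuantumFieldTheory (haarProbability LatticeRep)
open Summit.QuantumFields.YangMills.Theorems.FreeEnergyLogCoefficient (dimE exists_haar_gball_ge)
open Summit.QuantumFields.YangMills.Cruxes.IR.Tempered (cellEdges)
open Summit.QuantumFields.YangMills.Theorems.OddTorusChessboard (cellSites)
open Summit.QuantumFields.YangMills.Theorems.IRTypLocalExcess (LocalExcess TypLxInt ballLinks IsInteriorBall
  ballLinks_subset_cellEdges dirichletAction_eq_wilsonBoundaryAction)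

namespace Summit.QuantumFields.YangMills.Theorems.IRKernelLargeField

/-! ## §4 The excess event is closed and measurable -/

section Closed

variable {d : ℕ} {G : Type*} [Group G] [TopologicalSpace G] [IsTopologicalGroup G] [CompactSpace G]
  {N : ℕ} (ρ : G →* Matrix (Fin N) (Fin N) ℂ)

omit [CompactSpace G] in
/-- The pinned energy `(U, ζ) ↦ S_E(ζ ∨ U)` is jointly continuous. -/
theorem continuous_pinnedEnergy (hρ : Continuous ρ) (E : Finset (ZdEdge d)) :
    Continuous fun p : LGConfig d G × (↥E → G) => wilsonBoundaryAction ρ E (glueWith E p.2 p.1) :=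
  (continuous_wilsonBoundaryAction ρ hρ E).comp (continuous_glueWith_prod E)

/-- The pinned infimum `U ↦ inf_ζ S_E(ζ ∨ U)` is continuous (Mathlib `IsCompact.continuous_sInf` on the compact fibre). -/
theorem continuous_pinnedInf (hρ : Continuous ρ) (E : Finset (ZdEdge d)) :
    Continuous fun U : LGConfig d G =>
      sInf ((fun ζ : ↥E → G => wilsonBoundaryAction ρ E (glueWith E ζ U)) '' Set.univ) :=
  IsCompact.continuous_sInf (f := fun (U : LGConfig d G) (ζ : ↥E → G) => wilsonBoundaryAction ρ E (glueWith E ζ U))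
    isCompact_univ (continuous_pinnedEnergy ρ hρ E)

/-- **The excess event as a sublevel comparison**: `U ∈ excessSet ρ E E₀ ↔ inf_ζ S_E(ζ ∨ U) + E₀ ≤ S_E(U)` (the infimum
is attained on the compact fibre). -/
theorem mem_excessSet_iff (hρ : Continuous ρ) (E : Finset (ZdEdge d)) (E₀ : ℝ) (U : LGConfig d G) :
    U ∈ excessSet ρ E E₀ ↔
      sInf ((fun ζ : ↥E → G => wilsonBoundaryAction ρ E (glueWith E ζ U)) '' Set.univ) + E₀ ≤
        wilsonBoundaryAction ρ E U := by
  set f : (↥E → G) → ℝ := fun ζ => wilsonBoundaryAction ρ E (glueWith E ζ U) with hf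
  have hc : Continuous f :=
    (continuous_wilsonBoundaryAction ρ hρ E).comp
      ((continuous_glueWith_prod E).comp (continuous_const.prodMk continuous_id))
  have hbdd : BddBelow (f '' Set.univ) := (isCompact_univ.image hc).bddBelow
  constructor
  · rintro ⟨V, hVU, hle⟩
    have hV : V = glueWith E (fun e : ↥E => V e) U := by
      funext e
      by_cases he : e ∈ E
      · rw [glueWith_apply_mem E _ U he]
      · rw [glueWith_apply_not_mem E _ U he, hVU e he]
    have h1 : sInf (f '' Set.univ) ≤ f (fun e : ↥E => V e) := csInf_le hbdd ⟨_, Set.mem_univ _, rfl⟩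
    have h2 : f (fun e : ↥E => V e) = wilsonBoundaryAction ρ E V := by rw [hf]; dsimp only; rw [← hV]
    linarith
  · intro h
    obtain ⟨ζ₀, _, hζ₀⟩ := isCompact_univ.exists_isMinOn Set.univ_nonempty hc.continuousOn
    have hmin : f ζ₀ ≤ sInf (f '' Set.univ) :=
      le_csInf ⟨f ζ₀, ζ₀, Set.mem_univ ζ₀, rfl⟩ (by
        rintro _ ⟨ζ, _, rfl⟩
        exact (isMinOn_iff.1 hζ₀) ζ (Set.mem_univ ζ))
    refine ⟨glueWith E ζ₀ U, fun e he => glueWith_apply_not_mem E ζ₀ U he, ?_⟩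
    have : f ζ₀ = wilsonBoundaryAction ρ E (glueWith E ζ₀ U) := rfl
    linarith

/-- **The excess event is closed** (usable in weak-limit passages). -/
theorem isClosed_excessSet (hρ : Continuous ρ) (E : Finset (ZdEdge d)) (E₀ : ℝ) :
    IsClosed (excessSet (G := G) ρ E E₀) := by
  have e : excessSet (G := G) ρ E E₀ =
      {U | sInf ((fun ζ : ↥E → G => wilsonBoundaryAction ρ E (glueWith E ζ U)) '' Set.univ) + E₀ ≤
        wilsonBoundaryAction ρ E U} :=
    Set.ext fun U => mem_excessSet_iff ρ hρ E E₀ U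
  rw [e]
  exact isClosed_le ((continuous_pinnedInf ρ hρ E).add continuous_const) (continuous_wilsonBoundaryAction ρ hρ E)

variable [MeasurableSpace G] [BorelSpace G] [SecondCountableTopology G]

/-- **The excess event is measurable** (closed, in the Borel = product σ-algebra of the countable product). -/
theorem measurableSet_excessSet (hρ : Continuous ρ) (E : Finset (ZdEdge d)) (E₀ : ℝ) :
    MeasurableSet (excessSet (G := G) ρ E E₀) :=
  (isClosed_excessSet ρ hρ E E₀).measurableSet

/-- **The energy-gap bound for the full excess event, sup over exteriors**: for `E ⊆ Λ`, every `ζ`, `δ ≥ 0` with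
`Haar{‖ρ g − 1‖ ≤ δ} ≥ m > 0`:
`γ_Λ(excessSet ρ E E₀ | ζ) ≤ exp(4 √N β δ · #(plaquettesTouching E) − β E₀) / m^{#E}`. -/
theorem kernel_measureReal_excessSet_le_of_subset [T2Space G] (hρ : Continuous ρ)
    (hU : ∀ g, ρ g ∈ Matrix.unitaryGroup (Fin N) ℂ) {β : ℝ} (hβ : 0 ≤ β) {E Λ : Finset (ZdEdge d)} (hEΛ : E ⊆ Λ)
    (ζ : LGConfig d G) (E₀ : ℝ) {δ m : ℝ} (hδ : 0 ≤ δ) (hm : 0 < m)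
    (hball : ENNReal.ofReal m ≤ haarProbability G {g : G | ‖ρ g - 1‖ ≤ δ}) :
    (ymSpecification ρ β Λ ζ).real (excessSet ρ E E₀) ≤
      Real.exp (β * (4 * Real.sqrt N * δ * (plaquettesTouching E).card) - β * E₀) / m ^ E.card :=
  kernel_measureReal_excess_le_of_subset ρ hρ hU hβ hEΛ ζ (measurableSet_excessSet ρ hρ E E₀) subset_rfl hδ hm hball

end Closed

/-! ## §5 Faithful representations: the zero-temperature scale `δ = 1/β` -/

section Rep

variable {d : ℕ} {G : Type*} [Group G] [TopologicalSpace G] [IsTopologicalGroup G] [CompactSpace G]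
  [MeasurableSpace G] [BorelSpace G] [SecondCountableTopology G] [T2Space G]

/-- **Excess-event rarity for a faithful lattice representation, zero-temperature scale.**  There is
`C₁ = C₁(r) > 0` such that for all `β ≥ 1`, all finite `E ⊆ Λ`, every exterior `ζ`, every level `E₀` and every
measurable `A ⊆ excessSet r.ρ E E₀`:
`γ_Λ(A | ζ) ≤ exp(4 √N · #(plaquettesTouching E) − β E₀) / (C₁ β^{−D})^{#E}`, `D = dimE r.ρ`
(`δ = β⁻¹` in `kernel_measureReal_excess_le_of_subset`, small-ball constant from `exists_haar_gball_ge`). -/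
theorem kernel_measureReal_excess_le_rep (r : LatticeRep G) :
    ∃ C₁ : ℝ, 0 < C₁ ∧ ∀ (β : ℝ), 1 ≤ β → ∀ (E Λ : Finset (ZdEdge d)), E ⊆ Λ → ∀ (ζ : LGConfig d G) (E₀ : ℝ)
      (A : Set (LGConfig d G)), MeasurableSet A → A ⊆ excessSet r.ρ E E₀ →
      (ymSpecification r.ρ β Λ ζ).real A ≤
        Real.exp (4 * Real.sqrt r.N * (plaquettesTouching E).card - β * E₀) / (C₁ * β⁻¹ ^ dimE r.ρ) ^ E.card := by
  obtain ⟨C₁, hC₁, hball⟩ := exists_haar_gball_ge r.ρ r.continuous r.injective r.mem_unitary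
  refine ⟨C₁, hC₁, fun β hβ E Λ hEΛ ζ E₀ A hA hAex => ?_⟩
  have hβ0 : 0 < β := by linarith
  have hδ : 0 < β⁻¹ := inv_pos.2 hβ0
  have hδ1 : β⁻¹ ≤ 1 := inv_le_one_of_one_le₀ hβ
  have hm : 0 < C₁ * β⁻¹ ^ dimE r.ρ := mul_pos hC₁ (pow_pos hδ _)
  have h := kernel_measureReal_excess_le_of_subset r.ρ r.continuous r.mem_unitary hβ0.le hEΛ ζ hA hAex hδ.le hm
    (hball _ hδ hδ1)
  have e : β * (4 * Real.sqrt r.N * β⁻¹ * (plaquettesTouching E).card) =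
      4 * Real.sqrt r.N * (plaquettesTouching E).card := by
    field_simp
  refine h.trans_eq ?_
  rw [e]

/-- The same for the full excess event. -/
theorem kernel_measureReal_excessSet_le_rep (r : LatticeRep G) :
    ∃ C₁ : ℝ, 0 < C₁ ∧ ∀ (β : ℝ), 1 ≤ β → ∀ (E Λ : Finset (ZdEdge d)), E ⊆ Λ → ∀ (ζ : LGConfig d G) (E₀ : ℝ),
      (ymSpecification r.ρ β Λ ζ).real (excessSet r.ρ E E₀) ≤
        Real.exp (4 * Real.sqrt r.N * (plaquettesTouching E).card - β * E₀) / (C₁ * β⁻¹ ^ dimE r.ρ) ^ E.card := by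
  obtain ⟨C₁, hC₁, h⟩ := kernel_measureReal_excess_le_rep (d := d) r
  exact ⟨C₁, hC₁, fun β hβ E Λ hEΛ ζ E₀ =>
    h β hβ E Λ hEΛ ζ E₀ _ (measurableSet_excessSet r.ρ r.continuous E E₀) subset_rfl⟩

/-- **Union over finitely many windows** (the shape of a cell's local-excess atypicality: «some window `W i`, `i ∈ I`,
has excess at least `E₀ i`»): for every faithful `LatticeRep`, with the constant `C₁` of
`kernel_measureReal_excessSet_le_rep`, for all `β ≥ 1`, finite families of windows `W i ⊆ Λ` and levels `E₀ i`, and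
every exterior `ζ`:
`γ_Λ(⋃_{i ∈ I} excessSet (W i) (E₀ i) | ζ) ≤ Σ_{i ∈ I} exp(4 √N · #(plaquettesTouching (W i)) − β E₀ i) / (C₁ β^{−D})^{#(W i)}`. -/
theorem kernel_measureReal_biUnion_excessSet_le_rep {ι : Type*} (r : LatticeRep G) :
    ∃ C₁ : ℝ, 0 < C₁ ∧ ∀ (β : ℝ), 1 ≤ β → ∀ (I : Finset ι) (W : ι → Finset (ZdEdge d)) (E₀ : ι → ℝ)
      (Λ : Finset (ZdEdge d)), (∀ i ∈ I, W i ⊆ Λ) → ∀ (ζ : LGConfig d G),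
      (ymSpecification r.ρ β Λ ζ).real (⋃ i ∈ I, excessSet r.ρ (W i) (E₀ i)) ≤
        ∑ i ∈ I, Real.exp (4 * Real.sqrt r.N * (plaquettesTouching (W i)).card - β * E₀ i) /
          (C₁ * β⁻¹ ^ dimE r.ρ) ^ (W i).card := by
  obtain ⟨C₁, hC₁, h⟩ := kernel_measureReal_excessSet_le_rep (d := d) r
  refine ⟨C₁, hC₁, fun β hβ I W E₀ Λ hW ζ => ?_⟩
  haveI : IsFiniteMeasure (ymSpecification r.ρ β Λ ζ) := by
    unfold ymSpecification; infer_instance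
  exact (measureReal_biUnion_finset_le I _).trans (Finset.sum_le_sum fun i hi => h β hβ (W i) Λ (hW i hi) ζ (E₀ i))

end Rep

/-! ## §6 Bridge to the local-excess class `Typ_lx^int` (`…Theorems.IRTypLocalExcess`, p516050) -/

section Bridge

variable {G : Type} [Group G] {N : ℕ} (ρ : G →* Matrix (Fin N) (Fin N) ℂ)

/-- **On an interior ball, failing the local-excess test at level `E` IS membership of the excess event of the ball's
links** (the own-Dirichlet functional is the kernel's Dirichlet energy there, `dirichletAction_eq_wilsonBoundaryAction`). -/
theorem setOf_not_localExcess_subset_excessSet {w : Fin 4 → ℤ → ℤ} {c : Fin 4 → ℤ} {R : ℕ} {x : Site 4}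
    (hint : IsInteriorBall w c R x) (E : ℝ) :
    {U : LGConfig 4 G | ¬ LocalExcess ρ w R E c x U} ⊆ excessSet ρ (ballLinks w c R x) E := by
  intro U hU
  simp only [Set.mem_setOf_eq, LocalExcess, not_forall, not_le, exists_prop] at hU
  obtain ⟨V, hV, hlt⟩ := hU
  refine ⟨V, hV, ?_⟩
  rw [← dirichletAction_eq_wilsonBoundaryAction ρ hint]
  exact hlt.le

/-- **The atypical set of `Typ_lx^int` is covered by the excess events of the cell's balls**: for a finite scale set
`Rs`, `(TypLxInt ρ w ↑Rs E c)ᶜ ⊆ ⋃_{(R, x) ∈ Rs × cellSites w c} excessSet ρ (ballLinks w c R x) (E R)` (the centre of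
an interior ball is a cell site). -/
theorem compl_typLxInt_subset (w : Fin 4 → ℤ → ℤ) (c : Fin 4 → ℤ) (Rs : Finset ℕ) (E : ℕ → ℝ) :
    (TypLxInt ρ w (↑Rs : Set ℕ) E c)ᶜ ⊆
      ⋃ p ∈ Rs ×ˢ cellSites w c, excessSet ρ (ballLinks w c p.1 p.2) (E p.1) := by
  intro U hU
  rw [Set.mem_compl_iff, TypLxInt, Set.mem_setOf_eq] at hU
  push Not at hU
  obtain ⟨R, x, hR, hint, hnot⟩ := hU
  have hx : x ∈ cellSites w c := hint x fun i => by
    rw [sub_self, abs_zero]; positivity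
  exact Set.mem_iUnion₂.2 ⟨(R, x), Finset.mem_product.2 ⟨Finset.mem_coe.1 hR, hx⟩,
    setOf_not_localExcess_subset_excessSet ρ hint (E R) hnot⟩

variable [TopologicalSpace G] [IsTopologicalGroup G] [CompactSpace G] [MeasurableSpace G] [BorelSpace G]
  [SecondCountableTopology G] [T2Space G]

/-- **Any-exterior single-cell rarity of the local-excess factor, explicit budget.**  For every faithful `LatticeRep`
there is `C₁ > 0` such that for all `β ≥ 1`, every frame `w`, cell `c`, finite scale set `Rs`, budget `E`, every
`Λ ⊇ cellEdges w c` and EVERY exterior `ζ`: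
`γ_Λ((TypLxInt r.ρ w Rs E c)ᶜ | ζ) ≤ Σ_{(R,x) ∈ Rs × cellSites w c} exp(4 √N · #(plaquettesTouching (ballLinks w c R x)) − β E R)
  / (C₁ β^{−D})^{#(ballLinks w c R x)}`, `D = dimE r.ρ`. -/
theorem kernel_measureReal_compl_typLxInt_le_rep (r : LatticeRep G) :
    ∃ C₁ : ℝ, 0 < C₁ ∧ ∀ (β : ℝ), 1 ≤ β → ∀ (w : Fin 4 → ℤ → ℤ) (c : Fin 4 → ℤ) (Rs : Finset ℕ) (E : ℕ → ℝ)
      (Λ : Finset (ZdEdge 4)), cellEdges w c ⊆ Λ → ∀ (ζ : LGConfig 4 G),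
      (ymSpecification r.ρ β Λ ζ).real (TypLxInt r.ρ w (↑Rs : Set ℕ) E c)ᶜ ≤
        ∑ p ∈ Rs ×ˢ cellSites w c,
          Real.exp (4 * Real.sqrt r.N * (plaquettesTouching (ballLinks w c p.1 p.2)).card - β * E p.1) /
            (C₁ * β⁻¹ ^ dimE r.ρ) ^ (ballLinks w c p.1 p.2).card := by
  obtain ⟨C₁, hC₁, h⟩ := kernel_measureReal_biUnion_excessSet_le_rep (d := 4) (ι := ℕ × Site 4) r
  refine ⟨C₁, hC₁, fun β hβ w c Rs E Λ hΛ ζ => ?_⟩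
  haveI : IsFiniteMeasure (ymSpecification r.ρ β Λ ζ) := by
    unfold ymSpecification; infer_instance
  have hW : ∀ p ∈ Rs ×ˢ cellSites w c, ballLinks w c p.1 p.2 ⊆ Λ := fun p _ =>
    (ballLinks_subset_cellEdges w c p.1 p.2).trans hΛ
  exact (measureReal_mono (compl_typLxInt_subset r.ρ w c Rs E) (measure_ne_top _ _)).trans
    (h β hβ (Rs ×ˢ cellSites w c) (fun p => ballLinks w c p.1 p.2) (fun p => E p.1) Λ hW ζ)

end Bridge

end Summit.QuantumFields.YangMills.Theorems.IRKernelLargeField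

end
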